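import Literature.MathematicalPhysics.QuantumFieldTheory.Balaban1983to89.B4ThmTorusBox

/-!
# `Balaban1983to89.B4LatticeBoxChart` — [Balaban1983RegularityDecay] THEOREM p. 573, (1.9)–(1.10) «for rectangular
# parallelepipeds … without any restrictions on the points x, x′», IN r01's REGION CURRENCY: a lattice parallelepiped
# `Ω = o + Π[0, Ms)` (unit labels) as an instance of the GENERAL region-pair family `regionPairFam` (`Ω₀ = Ω`), and the
# transfer of r04∕p17's box Theorem (`boxPairFamNC`, `rect := True`) to it along p23's chart `eB` — so that
# `Ineq19_110 (regionPairFam …) α δ₀ c₀ R₀` holds for EVERY `R₀` (in particular `R₀ = 0`: no restriction)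

statement-level skeleton of published theorems with citation tags; proofs where landed; nothing here is a claim about the Yang–Mills mass gap

CITATION HEADER.  T. Bałaban, *Regularity and decay of lattice Green's functions*, Commun. Math. Phys. **89** (1983)
571–597, doi:10.1007/bf01214744 [Balaban1983RegularityDecay] (cell paper B4; held text
`paper:balaban1983-cmp89-regularity-decay`, journal page = PDF page + 570; p. 573 [PDF 3] Theorem (1.9)–(1.10) and its
last sentence, p. 572 [PDF 2] (1.1)–(1.7)).  Seat `pub-ymgap-dag-p3` gen 4 (Track A, YM-PLAN §2 node N01 = [B4]; HOME
`run/shared/lean/pub/pub-ymgap/`): SECOND BRICK of the route to the `rect` residual (i) of N01's cross-read (wrapping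
bands of `T_η`; first brick `B4RegionDecoupling`): the components of the periodic lift of a band are lattice
parallelepipeds `o + Π[0,Ms)` INSIDE r01's lifted region; after decoupling, each is the region instance `toRegion` below,
and this file puts the box lineage's unrestricted (1.9)–(1.10) on it.  Imports dag-p3 g3 `B4ThmTorusBox` (→ g3
`B4TorusBoxReindex`: the chart lemmas `eB_val`, `eB_sub`, `val_eq_symm_add`, `compField_eB`, `add_mem_fineDom_iff`,
`covDeriv_submatrix_eB`, `fld_comp_eBι`, `supN_comp_eBι`, `submatrix_mulVec_comp_eBι`, `transport_map`, `pathEnd_map`,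
`supNorm_sub_le_length`, `le_holderQ_box`; → p23 g19 `B2Lemma24KerOmega`: `boxLabels`, `eB`, `eBquiv`, `eBι`, `shiftF`,
`regionOp_submatrix_eB`; → r04 `B4ThmBoxPairEtaNoCollar`: `boxPairFamNC`; → r01 g8 `B4ThmRegionPairEta`: `RegionPairInst`,
`regionPairFam`; → r01 g9 `B4ThmTorusPairEta.decay_mono`, `B4Thm19ShortestContour.le_holderQ`).

WHAT IS PRINTED.  p. 573 [PDF 3], verbatim: «For some simple sets Ω, e.g. for rectangular parallelepipeds, the
inequalities hold without any restrictions on the points x, x′, i.e. for all x, x′ ∈ Ω.»; p. 572 [PDF 2]: «We consider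
operators on subsets of the lattice ηZ^d, η = L^{−k}.»

WHAT THIS MODULE PROVES (kernel, sorry-free).  ONE structure `LatBoxInst` (an instance: scale `k ≥ 1`, unit sides
`Ms_ν ≥ 1`, label corner `o ∈ ℤ^{d+1}`, `(a, m²)` in the windows, a component field `A_c` on the fine lattice, a coupling
`e`) with two readings: **`toRegion`** — r01's `RegionPairInst` with `Ω = Ω₀ =` the unit blocks with labels in
`boxLabels Ms o = o + Π[0,Ms)` at the field `A_c`; **`boxI`** — r04∕p17's `BoxPairInst` with `Mb = Ms`, offset `0`, at
the translated field `shiftF ℓ k o A_c = A_c(· + n·o)` (as dag-p3 g3's `TorusBoxInst.boxI`, with the torus replaced by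
the lattice).  Then:
* §1 dictionary: `AΩ_boxI`, `GΩ_boxI`, `DΩ_boxI` (the box instance's letters `greenA` ∕ `derivA`), `GΩ_comp_eBι`,
  `DΩ_comp_eBι`, `DΩGΩ_comp_eBι`, `fld_GΩ_eB`, `fld_DΩGΩ_eB` — **`G_k(Ω,A)f ∘ eB = greenA(f ∘ eB)`** etc. for the REGION
  instance (p23's `regionOp_submatrix_eB`, no torus hypothesis); hypothesis transfers `regular_boxI`, `bigBlocks_boxI`.
* §2 sources and contours along the chart (a translation): `mem_supp_comp_iff`, **`sdist1_eB`** ∕ **`sdist1_symm_eq`** (the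
  distances to the support AGREE), `symm_sub_eq`, `isNNChain_map_symm_region`, `adm_symm_of_adm` (an admissible region contour read on the box is admissible, same
  length, ball and end bonds), `wt_symm_eq`, `transport_eq_transport_symm` (same transporter), `term_le_holderQ_box`.
* §3 THE MEMBERS: from `HB : Ineq19_110 (boxPairFamNC … K′ j.boxI) α δ_B c_B R_B` — `valG_region`, `valDG_region`
  ((1.10) at EVERY site), `lhs19_region` ((1.9) at EVERY pair, same constant), and **`ineq19_110_toRegion`**:
  `Ineq19_110 (regionPairFam F d ℓ a₋ a₊ m²₊ c β K j.toRegion) α δ_B c_B R₀` for EVERY `R₀` (the `R₀`-disjunct is never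
  used: `rect := False` on r01's family, but the bound holds at all points).
HONEST SCOPE.  Re-indexing only (no analytic estimate); abelian one-parameter flow, component fields, staircase
contours, `ℓ^∞` metric, Euclidean site norms, `lhs19` = sup over admissible contours — all as in the two source
families; `K` (r01's modulus) is idle here, `K′` (r04's) enters through `HB`.  One `structure` + two `abbrev` instances
(definition lane); no `Prop` fact, no `sorry`; axioms standard.  Count-neutral for YM-PLAN (typed 28∕28; discharged
count unmoved); nothing here concerns the continuum limit, ℝ⁴, OS axioms, a mass gap or the Clay problem.
-/

namespace Literature.MathematicalPhysics.QuantumFieldTheory.Balaban1983to89.B4LatticeBoxChart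

open Literature.MathematicalPhysics.QuantumFieldTheory.Balaban1983to89
open Literature.MathematicalPhysics.QuantumFieldTheory.Balaban1983to89.B4 (EtaSetting Ineq19_110)
open Literature.MathematicalPhysics.QuantumFieldTheory.Balaban1983to89.B4Reflection242 (boxDom mem_boxDom nbrs mem_nbrs
  blk)
open Literature.MathematicalPhysics.QuantumFieldTheory.Balaban1983to89.B4GaugeCovariance
open Literature.MathematicalPhysics.QuantumFieldTheory.Balaban1983to89.B4ContourShift (supNorm supNorm_nonneg)
open Literature.MathematicalPhysics.QuantumFieldTheory.Balaban1983to89.B4Lower18 (fineDom mem_fineDom)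
open Literature.MathematicalPhysics.QuantumFieldTheory.Balaban1983to89.B4Lower18Regular (e1 baseEmb stairContour PathRel)
open Literature.MathematicalPhysics.QuantumFieldTheory.Balaban1983to89.B4Lower18RegularRegion (compField transport_congr)
open Literature.MathematicalPhysics.QuantumFieldTheory.Balaban1983to89.B4Lemma21Region (regionOp regionDeriv covDeriv
  siteNorm)
open Literature.MathematicalPhysics.QuantumFieldTheory.Balaban1983to89.B4Lemma22ReduceZero (Box opA greenA derivA)
open Literature.MathematicalPhysics.QuantumFieldTheory.Balaban1983to89.B4Lemma22Reduce231 (supN supN_nonneg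
  siteNorm_nonneg)
open Literature.MathematicalPhysics.QuantumFieldTheory.Balaban1983to89.B4Lemma22HolderBox (IsNNChain)
open Literature.MathematicalPhysics.QuantumFieldTheory.Balaban1983to89.B4Eq221L2FactorRegion (acBond)
open Literature.MathematicalPhysics.QuantumFieldTheory.Balaban1983to89.B4RegionCubeCarrier (compField_add)
open Literature.MathematicalPhysics.QuantumFieldTheory.Balaban1983to89.B2Lemma24SupG (κS embS ΓS)
open Literature.MathematicalPhysics.QuantumFieldTheory.Balaban1983to89.B2Lemma24KerOmega (boxLabels mem_boxLabels eB
  eBquiv eBι eBι_eq eBquiv_apply shiftF eB_surjective regionOp_submatrix_eB hnk)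
open Literature.MathematicalPhysics.QuantumFieldTheory.Balaban1983to89.B4ThmRegionPairEta (RegionPairInst regionPairFam)
open Literature.MathematicalPhysics.QuantumFieldTheory.Balaban1983to89.B4ThmBoxPairEta (BoxPairInst boxPairFam)
open Literature.MathematicalPhysics.QuantumFieldTheory.Balaban1983to89.B4ThmBoxPairEtaNoCollar (boxPairFamNC)
open Literature.MathematicalPhysics.QuantumFieldTheory.Balaban1983to89.B4ThmTorusPairEta (decay_mono)
open Literature.MathematicalPhysics.QuantumFieldTheory.Balaban1983to89.B4Thm19ShortestContour (le_holderQ)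
open Literature.MathematicalPhysics.QuantumFieldTheory.Balaban1983to89.B4TorusBoxReindex (eB_val eB_sub val_eq_symm_add
  compField_eB add_mem_fineDom_iff covDeriv_submatrix_eB fld_comp_eBι supN_comp_eBι submatrix_mulVec_comp_eBι
  transport_map pathEnd_map)
open Literature.MathematicalPhysics.QuantumFieldTheory.Balaban1983to89.B4ThmTorusBox (le_holderQ_box supNorm_sub_le_length)
open scoped Matrix

noncomputable section

variable {d : ℕ} {ι : Type} [Fintype ι] [DecidableEq ι]

/-- AN INSTANCE OF THE THEOREM ON A LATTICE PARALLELEPIPED: a scale `k ≥ 1` (`η = (ℓ+1)^{−k}`), the unit sides `Ms`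
and the label corner `o` of the parallelepiped `Ω` = the unit blocks with labels in `o + Π_ν[0, Ms_ν)` ⊂ ℤ^{d+1},
`(a, m²)` in the windows `[a₋,a₊] × [0,m²₊]`, a component field `A_c` on the fine lattice and a coupling `e`.
[cite: Balaban1983RegularityDecay, Theorem p.573 «for rectangular parallelepipeds», (1.1)–(1.6) p.572] -/
structure LatBoxInst (d ℓ : ℕ) (amin aplus m2plus : ℝ) where
  /-- the scale -/
  k : ℕ
  hk : 1 ≤ k
  /-- unit sides and label corner of the parallelepiped -/
  Ms : Fin (d + 1) → ℕ
  o : Fin (d + 1) → ℤ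
  hMs : ∀ ν, 1 ≤ Ms ν
  /-- the averaging weight `a` and the mass `m²` -/
  a : ℝ
  m2 : ℝ
  ha1 : amin ≤ a
  ha2 : a ≤ aplus
  hm1 : 0 ≤ m2
  hm2 : m2 ≤ m2plus
  /-- the component field `A_c` on the fine lattice -/
  Ac : (Fin (d + 1) → ℤ) → Fin (d + 1) → ℝ
  /-- the coupling -/
  e : ℝ

namespace LatBoxInst

variable {ℓ : ℕ} {amin aplus m2plus : ℝ} (j : LatBoxInst d ℓ amin aplus m2plus)

/-- THE REGION READING: r01's pair instance `Ω ⊂ Ω₀` with `Ω = Ω₀ =` the parallelepiped, at the field `A_c`.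
[cite: Balaban1983RegularityDecay, Theorem p.573, (1.6) p.572 (dictionary)] -/
abbrev toRegion : RegionPairInst d ℓ amin aplus m2plus where
  k := j.k
  hk := j.hk
  Ω₀c := boxLabels j.Ms j.o
  Ωc := boxLabels j.Ms j.o
  hsub := Finset.Subset.refl _
  a := j.a
  m2 := j.m2
  ha1 := j.ha1
  ha2 := j.ha2
  hm1 := j.hm1
  hm2 := j.hm2
  Ac := j.Ac
  e := j.e

/-- THE BOX READING: r04∕p17's box pair `Ω̃ ⊂ Ω̃` (`Ω̃ = Π[0, nMs)`, offset `0`) at the translated field `A_c(· + n·o)`.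
[cite: Balaban1983RegularityDecay, Theorem p.573 «for rectangular parallelepipeds», (1.1) p.572 (dictionary)] -/
abbrev boxI : BoxPairInst d ℓ amin aplus m2plus where
  k := j.k
  hk := j.hk
  Mb := j.Ms
  Ms := j.Ms
  o := 0
  ho := fun i => by simp
  hMs := j.hMs
  a := j.a
  m2 := j.m2
  ha1 := j.ha1
  ha2 := j.ha2
  hm1 := j.hm1
  hm2 := j.hm2
  Ac := shiftF ℓ j.k j.o j.Ac
  e := j.e

/-! ## §1. Dictionary: the region instance read on the box is the box instance -/

section Dictionary

/-- the box instance's field is the translated component field. [cite: Balaban1983RegularityDecay, p.572 «A_{⟨x,x+ηe_μ⟩} = A_μ(x)», dictionary] -/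
theorem AΩ_boxI : j.boxI.AΩ = fun u v => compField (shiftF ℓ j.k j.o j.Ac) u.1 v.1 := by
  funext u v
  show compField (fun w => shiftF ℓ j.k j.o j.Ac
    (w + fun i => (((ℓ + 1) ^ j.k : ℕ) : ℤ) * ((0 : Fin (d + 1) → ℕ) i : ℤ))) u.1 v.1 = _
  have h0 : (fun i : Fin (d + 1) => (((ℓ + 1) ^ j.k : ℕ) : ℤ) * ((0 : Fin (d + 1) → ℕ) i : ℤ)) = 0 := by
    funext i; simp
  rw [h0]
  simp only [add_zero]

/-- `G_k(Ω̃, Ã)` of the box instance, in the box lineage's letters. [cite: Balaban1983RegularityDecay, (1.6) p.572, dictionary] -/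
theorem GΩ_boxI (F : OrthFlow ι) : j.boxI.GΩ F
    = greenA d F (κS ℓ j.k j.e) ℓ j.k j.a j.m2 j.Ms (embS d ℓ j.k j.Ms) (ΓS d ℓ j.k j.Ms)
        (fun u v => compField (shiftF ℓ j.k j.o j.Ac) u.1 v.1) := by
  show greenA d F j.boxI.κ ℓ j.k j.a j.m2 j.Ms _ _ j.boxI.AΩ = _
  rw [AΩ_boxI]
  rfl

/-- `D^η_{Ã,μ}` of the box instance, in the box lineage's letters. [cite: Balaban1983RegularityDecay, (1.3) p.572, dictionary] -/
theorem DΩ_boxI (F : OrthFlow ι) (μ : Fin (d + 1)) : j.boxI.DΩ F μ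
    = derivA d F (κS ℓ j.k j.e) ℓ j.k j.Ms (fun u v => compField (shiftF ℓ j.k j.o j.Ac) u.1 v.1) μ := by
  show derivA d F j.boxI.κ ℓ j.k j.Ms j.boxI.AΩ μ = _
  rw [AΩ_boxI]
  rfl

variable (F : OrthFlow ι)

/-- **`H_k(Ω,A)` OF THE REGION INSTANCE RE-INDEXED ALONG THE CHART IS `opA`** (p23's `regionOp_submatrix_eB`).
[cite: Balaban1983RegularityDecay, (1.3)–(1.6) p.572 «operators on subsets of the lattice ηZ^d»] -/
theorem regionOp_toRegion_submatrix_eB :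
    (regionOp F j.e (hnk ℓ j.k) (B1.aSeq j.a ((ℓ : ℝ) + 1) j.k) j.m2 (boxLabels j.Ms j.o) j.Ac).submatrix
        (Prod.map (eB ℓ j.k j.Ms j.o) id) (Prod.map (eB ℓ j.k j.Ms j.o) id)
      = opA d F (κS ℓ j.k j.e) ℓ j.k j.a j.m2 j.Ms (embS d ℓ j.k j.Ms) (ΓS d ℓ j.k j.Ms)
          (fun u v => compField (shiftF ℓ j.k j.o j.Ac) u.1 v.1) :=
  regionOp_submatrix_eB F j.e ℓ j.k j.a j.m2 j.Ms j.o j.Ac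

/-- **`G_k(Ω,A)` OF THE REGION INSTANCE RE-INDEXED ALONG THE CHART IS `greenA`** (`Matrix.inv_submatrix_equiv`).
[cite: Balaban1983RegularityDecay, (1.6) p.572 «G_k(Ω, A) = (…)^{−1}»] -/
theorem GΩ_toRegion_submatrix : (j.toRegion.GΩ F).submatrix (eBι ℓ j.k j.Ms j.o) (eBι ℓ j.k j.Ms j.o) = j.boxI.GΩ F := by
  rw [GΩ_boxI]
  show ((regionOp F j.e _ (B1.aSeq j.a ((ℓ : ℝ) + 1) j.k) j.m2 (boxLabels j.Ms j.o) j.Ac)⁻¹).submatrix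
      (eBι ℓ j.k j.Ms j.o) (eBι ℓ j.k j.Ms j.o) = _
  rw [← Matrix.inv_submatrix_equiv, eBι_eq, regionOp_toRegion_submatrix_eB]
  rfl

/-- **`(G_k(Ω,A)f) ∘ eB = greenA (f ∘ eB)`** for the region instance. [cite: Balaban1983RegularityDecay, (1.6) p.572, (1.10) p.573] -/
theorem GΩ_comp_eBι (f : ↥(fineDom ((ℓ + 1) ^ j.k) (boxLabels j.Ms j.o)) × ι → ℝ) :
    (j.toRegion.GΩ F *ᵥ f) ∘ ⇑(eBι (ι := ι) ℓ j.k j.Ms j.o) = j.boxI.GΩ F *ᵥ (f ∘ ⇑(eBι (ι := ι) ℓ j.k j.Ms j.o)) := by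
  rw [← GΩ_toRegion_submatrix, submatrix_mulVec_comp_eBι]

/-- `D^η_{A,μ}` of the region instance re-indexed along the chart is `derivA` at the translated field.
[cite: Balaban1983RegularityDecay, (1.3) p.572] -/
theorem DΩ_toRegion_submatrix (μ : Fin (d + 1)) :
    (j.toRegion.DΩ F μ).submatrix (eBι ℓ j.k j.Ms j.o) (eBι ℓ j.k j.Ms j.o) = j.boxI.DΩ F μ := by
  rw [DΩ_boxI]
  show (regionDeriv F j.e ((ℓ + 1) ^ j.k) (boxLabels j.Ms j.o) j.Ac μ).submatrix _ _ = _
  rw [regionDeriv, covDeriv_submatrix_eB]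
  unfold derivA
  congr 1
  funext a b
  show F.U (_ * compField _ (eB ℓ j.k j.Ms j.o a).1 (eB ℓ j.k j.Ms j.o b).1) = F.U (_ * _)
  rw [compField_eB]
  rfl

/-- **`(D_μv) ∘ eB = derivA (v ∘ eB)`** for the region instance. [cite: Balaban1983RegularityDecay, (1.3) p.572] -/
theorem DΩ_comp_eBι (μ : Fin (d + 1)) (v : ↥(fineDom ((ℓ + 1) ^ j.k) (boxLabels j.Ms j.o)) × ι → ℝ) :
    (j.toRegion.DΩ F μ *ᵥ v) ∘ ⇑(eBι (ι := ι) ℓ j.k j.Ms j.o) = j.boxI.DΩ F μ *ᵥ (v ∘ ⇑(eBι (ι := ι) ℓ j.k j.Ms j.o)) := by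
  rw [← DΩ_toRegion_submatrix, submatrix_mulVec_comp_eBι]

/-- `(D_μG_k(Ω,A)f) ∘ eB = derivA (greenA (f ∘ eB))`. [cite: Balaban1983RegularityDecay, (1.9)–(1.10) p.573] -/
theorem DΩGΩ_comp_eBι (μ : Fin (d + 1)) (f : ↥(fineDom ((ℓ + 1) ^ j.k) (boxLabels j.Ms j.o)) × ι → ℝ) :
    (j.toRegion.DΩ F μ *ᵥ (j.toRegion.GΩ F *ᵥ f)) ∘ ⇑(eBι (ι := ι) ℓ j.k j.Ms j.o)
      = j.boxI.DΩ F μ *ᵥ (j.boxI.GΩ F *ᵥ (f ∘ ⇑(eBι (ι := ι) ℓ j.k j.Ms j.o))) := by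
  rw [DΩ_comp_eBι, GΩ_comp_eBι]

/-- `(G_k(Ω,A)f)(eB z) = (greenA (f ∘ eB))(z)`. [cite: Balaban1983RegularityDecay, (1.10) p.573] -/
theorem fld_GΩ_eB (f : ↥(fineDom ((ℓ + 1) ^ j.k) (boxLabels j.Ms j.o)) × ι → ℝ) (z : ↥(Box d ℓ j.k j.Ms)) :
    fld (j.toRegion.GΩ F *ᵥ f) (eB ℓ j.k j.Ms j.o z) = fld (j.boxI.GΩ F *ᵥ (f ∘ ⇑(eBι (ι := ι) ℓ j.k j.Ms j.o))) z := by
  rw [← GΩ_comp_eBι]; rfl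

/-- `(D_μG_k(Ω,A)f)(eB z) = (derivA (greenA (f ∘ eB)))(z)`. [cite: Balaban1983RegularityDecay, (1.9)–(1.10) p.573] -/
theorem fld_DΩGΩ_eB (μ : Fin (d + 1)) (f : ↥(fineDom ((ℓ + 1) ^ j.k) (boxLabels j.Ms j.o)) × ι → ℝ)
    (z : ↥(Box d ℓ j.k j.Ms)) :
    fld (j.toRegion.DΩ F μ *ᵥ (j.toRegion.GΩ F *ᵥ f)) (eB ℓ j.k j.Ms j.o z)
      = fld (j.boxI.DΩ F μ *ᵥ (j.boxI.GΩ F *ᵥ (f ∘ ⇑(eBι (ι := ι) ℓ j.k j.Ms j.o)))) z := by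
  rw [← DΩGΩ_comp_eBι]; rfl

variable {creg β : ℝ} {K K' : ℕ}

/-- **(1.7) TRANSFERS TO THE BOX INSTANCE**: if `A_c` is (1.7)-regular on `Ω` (the region family's clause: `Ω₀ = Ω`),
the translated field is (1.7)-regular on `Ω̃` (r04's collar-free clause). [cite: Balaban1983RegularityDecay, (1.7) p.572] -/
theorem regular_boxI (h : (regionPairFam F d ℓ amin aplus m2plus creg β K j.toRegion).regular) :
    (boxPairFamNC F d ℓ amin aplus m2plus creg β K' j.boxI).regular := by
  dsimp only [regionPairFam] at h
  dsimp only [boxPairFamNC, boxPairFam]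
  intro x hx μ ν
  have hx' : (x + fun i => (((ℓ + 1) ^ j.k : ℕ) : ℤ) * j.o i) ∈ fineDom ((ℓ + 1) ^ j.k) (boxLabels j.Ms j.o) :=
    (add_mem_fineDom_iff ℓ j.k j.Ms j.o x).2 hx
  have h' := h _ hx' μ ν
  simp only [shiftF]
  rw [add_right_comm x (e1 μ)]
  exact h'

/-- the big-block clause of the box instance is `K′ ∣ Ms_ν`. [cite: Balaban1983RegularityDecay, p.572 «unions of big blocks»] -/
theorem bigBlocks_boxI (h : ∀ ν, K' ∣ j.Ms ν) :
    (boxPairFamNC F d ℓ amin aplus m2plus creg β K' j.boxI).bigBlocks := ⟨h, h⟩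

end Dictionary

/-! ## §2. Sources and contours along the chart (a translation: distances, weights and transporters agree) -/

section Chart

variable (F : OrthFlow ι)

omit [DecidableEq ι] in
/-- the support of a source read on the box is the chart preimage of its support (both supports are the sites carrying a
non-zero component). [cite: Balaban1983RegularityDecay, (1.9) p.573 «supp f», dictionary] -/
theorem mem_supp_comp_iff (f : ↥(fineDom ((ℓ + 1) ^ j.k) (boxLabels j.Ms j.o)) × ι → ℝ) (z : ↥(Box d ℓ j.k j.Ms)) :
    z ∈ j.boxI.supp (f ∘ ⇑(eBι (ι := ι) ℓ j.k j.Ms j.o)) ↔ eB ℓ j.k j.Ms j.o z ∈ j.toRegion.supp f := by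
  unfold BoxPairInst.supp RegionPairInst.supp
  simp only [Finset.mem_filter, Finset.mem_univ, true_and]
  exact Iff.rfl

omit [DecidableEq ι] in
/-- **THE DISTANCES TO THE SUPPORT AGREE ALONG THE CHART**: `dist(eB z, supp f) = dist(z, supp(f ∘ eB))` (a translation
does not change differences). [cite: Balaban1983RegularityDecay, (1.10) p.573 «dist(x, supp f)», dictionary] -/
theorem sdist1_eB (f : ↥(fineDom ((ℓ + 1) ^ j.k) (boxLabels j.Ms j.o)) × ι → ℝ) (z : ↥(Box d ℓ j.k j.Ms)) :
    j.toRegion.sdist1 (eB ℓ j.k j.Ms j.o z) f = j.boxI.sdist1 z (f ∘ ⇑(eBι (ι := ι) ℓ j.k j.Ms j.o)) := by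
  by_cases hne : (j.boxI.supp (f ∘ ⇑(eBι (ι := ι) ℓ j.k j.Ms j.o))).Nonempty
  · have hne' : (j.toRegion.supp f).Nonempty := by
      obtain ⟨z', hz'⟩ := hne
      exact ⟨_, (j.mem_supp_comp_iff f z').1 hz'⟩
    unfold BoxPairInst.sdist1 RegionPairInst.sdist1
    rw [dif_pos hne, dif_pos hne']
    apply le_antisymm
    · refine Finset.le_inf' _ _ fun z' hz' => ?_
      refine (Finset.inf'_le _ ((j.mem_supp_comp_iff f z').1 hz')).trans (le_of_eq ?_)
      show supNorm ((eB ℓ j.k j.Ms j.o z).1 - (eB ℓ j.k j.Ms j.o z').1) / _ = supNorm (z.1 - z'.1) / _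
      rw [eB_sub]
    · refine Finset.le_inf' _ _ fun x' hx' => ?_
      obtain ⟨z', rfl⟩ := eB_surjective ℓ j.k j.Ms j.o x'
      refine (Finset.inf'_le _ ((j.mem_supp_comp_iff f z').2 hx')).trans (le_of_eq ?_)
      show supNorm (z.1 - z'.1) / _ = supNorm ((eB ℓ j.k j.Ms j.o z).1 - (eB ℓ j.k j.Ms j.o z').1) / _
      rw [eB_sub]
  · have hne' : ¬ (j.toRegion.supp f).Nonempty := by
      rintro ⟨w, hw⟩
      obtain ⟨z', rfl⟩ := eB_surjective ℓ j.k j.Ms j.o w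
      exact hne ⟨z', (j.mem_supp_comp_iff f z').2 hw⟩
    unfold BoxPairInst.sdist1 RegionPairInst.sdist1
    rw [dif_neg hne, dif_neg hne']

omit [DecidableEq ι] in
/-- the same at a site of `Ω` and its back-translate. [cite: Balaban1983RegularityDecay, (1.10) p.573 «dist(x, supp f)», dictionary] -/
theorem sdist1_symm_eq (f : ↥(fineDom ((ℓ + 1) ^ j.k) (boxLabels j.Ms j.o)) × ι → ℝ)
    (x : ↥(fineDom ((ℓ + 1) ^ j.k) (boxLabels j.Ms j.o))) :
    j.boxI.sdist1 ((eBquiv ℓ j.k j.Ms j.o).symm x) (f ∘ ⇑(eBι (ι := ι) ℓ j.k j.Ms j.o)) = j.toRegion.sdist1 x f := by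
  have := j.sdist1_eB f ((eBquiv ℓ j.k j.Ms j.o).symm x)
  rw [← eBquiv_apply, Equiv.apply_symm_apply] at this
  exact this.symm

omit [Fintype ι] [DecidableEq ι] in
/-- differences of back-translates along p23's chart are the differences (any label box `o′ + Π[0,Ms′)`).
[cite: Balaban1983RegularityDecay, (1.9) p.573 «|x − x′|», dictionary] -/
theorem symm_sub_eq (Ms' : Fin (d + 1) → ℕ) (o' : Fin (d + 1) → ℤ)
    (x z : ↥(fineDom ((ℓ + 1) ^ j.k) (boxLabels Ms' o'))) :
    ((eBquiv ℓ j.k Ms' o').symm z).1 - ((eBquiv ℓ j.k Ms' o').symm x).1 = z.1 - x.1 := by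
  conv_rhs => rw [val_eq_symm_add ℓ j.k Ms' o' z, val_eq_symm_add ℓ j.k Ms' o' x]
  rw [add_sub_add_right_eq_sub]

omit [Fintype ι] [DecidableEq ι] in
/-- a fine point of `Ω` shifted by a lattice vector lies in `Ω` iff its back-translate shifted lies in the box.
[cite: Balaban1983RegularityDecay, (1.1) p.572, dictionary] -/
theorem add_mem_iff_symm (x : ↥(fineDom ((ℓ + 1) ^ j.k) (boxLabels j.Ms j.o))) (w : Fin (d + 1) → ℤ) :
    x.1 + w ∈ fineDom ((ℓ + 1) ^ j.k) (boxLabels j.Ms j.o) ↔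
      ((eBquiv ℓ j.k j.Ms j.o).symm x).1 + w ∈ Box d ℓ j.k j.Ms := by
  rw [val_eq_symm_add ℓ j.k j.Ms j.o x, add_right_comm]
  exact add_mem_fineDom_iff ℓ j.k j.Ms j.o _

omit [Fintype ι] [DecidableEq ι] in
/-- a nearest-neighbour chain of the region instance read on the box is a nearest-neighbour chain of the box (every
lattice bond translates). [cite: Balaban1983RegularityDecay, p.573 «Γ_{x,x′} … contour», dictionary] -/
theorem isNNChain_map_symm_region : ∀ (x : ↥(fineDom ((ℓ + 1) ^ j.k) (boxLabels j.Ms j.o)))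
    (l : List ↥(fineDom ((ℓ + 1) ^ j.k) (boxLabels j.Ms j.o))), IsNNChain x l →
      IsNNChain ((eBquiv ℓ j.k j.Ms j.o).symm x) (l.map (eBquiv ℓ j.k j.Ms j.o).symm) := by
  intro x l
  induction l generalizing x with
  | nil => intro _; simp [IsNNChain]
  | cons y l ih =>
      rintro ⟨hxy, hl⟩
      refine ⟨?_, ih y hl⟩
      have hnb : y.1 ∈ nbrs x.1 := hxy
      rw [val_eq_symm_add ℓ j.k j.Ms j.o x, val_eq_symm_add ℓ j.k j.Ms j.o y] at hnb
      exact (B4SubBoxCarrier.mem_nbrs_add_iff _ _ _).1 hnb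

omit [Fintype ι] [DecidableEq ι] in
/-- **AN ADMISSIBLE CONTOUR OF THE REGION INSTANCE, READ ON THE BOX, IS AN ADMISSIBLE BOX CONTOUR** (same end bonds,
length, ball). [cite: Balaban1983RegularityDecay, p.573 «Γ_{x,x′} denotes a shortest contour», (1.9) p.573] -/
theorem adm_symm_of_adm {μ : Fin (d + 1)} {x x' : ↥(fineDom ((ℓ + 1) ^ j.k) (boxLabels j.Ms j.o))}
    {l : List ↥(fineDom ((ℓ + 1) ^ j.k) (boxLabels j.Ms j.o))} (hl : j.toRegion.Adm μ x x' l) :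
    j.boxI.Adm μ ((eBquiv ℓ j.k j.Ms j.o).symm x) ((eBquiv ℓ j.k j.Ms j.o).symm x')
      (l.map (eBquiv ℓ j.k j.Ms j.o).symm) := by
  obtain ⟨hbx, hbx', hne, hpath, hend, hlen, hball⟩ := hl
  refine ⟨(j.add_mem_iff_symm x (e1 μ)).1 hbx, (j.add_mem_iff_symm x' (e1 μ)).1 hbx', ?_,
    j.isNNChain_map_symm_region x l hpath, ?_, ?_, ?_⟩
  · intro h
    apply hne
    rw [val_eq_symm_add ℓ j.k j.Ms j.o x', val_eq_symm_add ℓ j.k j.Ms j.o x, h]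
  · rw [pathEnd_map, hend]
  · show ((l.map (eBquiv ℓ j.k j.Ms j.o).symm).length : ℝ) ≤ ((d : ℝ) + 1) * supNorm (_ - _)
    rw [List.length_map, j.symm_sub_eq j.Ms j.o]
    exact hlen
  · intro z' hz'
    obtain ⟨z, hz, rfl⟩ := List.mem_map.1 hz'
    show supNorm (_ - _) ≤ supNorm (_ - _)
    rw [j.symm_sub_eq j.Ms j.o, j.symm_sub_eq j.Ms j.o]
    exact hball z hz

omit [Fintype ι] [DecidableEq ι] in
/-- the Hölder weights agree. [cite: Balaban1983RegularityDecay, (1.9) p.573 «|x − x′|^{−α}», dictionary] -/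
theorem wt_symm_eq (α : ℝ) (x x' : ↥(fineDom ((ℓ + 1) ^ j.k) (boxLabels j.Ms j.o))) :
    j.boxI.wt α ((eBquiv ℓ j.k j.Ms j.o).symm x) ((eBquiv ℓ j.k j.Ms j.o).symm x') = j.toRegion.wt α x x' := by
  show (_ / supNorm (_ - _)) ^ α = (_ / supNorm (_ - _)) ^ α
  rw [j.symm_sub_eq j.Ms j.o]

/-- **THE TRANSPORTERS AGREE**: `U(A(Γ))` along a chain `Γ` of `Ω` (the region's links at `A_c`) is `U(Ã(eB⁻¹Γ))` along
the chain read on the box (the box instance's links at the translated field) — a translation of all bonds.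
[cite: Balaban1983RegularityDecay, (1.4) p.572 «U(A(Γ))», (1.9) p.573 «U(A(Γ_{x,x′}))»] -/
theorem transport_eq_transport_symm (κ : ℝ) (x : ↥(fineDom ((ℓ + 1) ^ j.k) (boxLabels j.Ms j.o)))
    (l : List ↥(fineDom ((ℓ + 1) ^ j.k) (boxLabels j.Ms j.o))) :
    transport (fieldLink F κ (acBond (boxLabels j.Ms j.o) j.Ac)) x l
      = transport (fieldLink F κ fun a b : ↥(Box d ℓ j.k j.Ms) => compField (shiftF ℓ j.k j.o j.Ac) a.1 b.1)
          ((eBquiv ℓ j.k j.Ms j.o).symm x) (l.map (eBquiv ℓ j.k j.Ms j.o).symm) := by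
  have hmap : (l.map (eBquiv ℓ j.k j.Ms j.o).symm).map (eB ℓ j.k j.Ms j.o) = l := by
    rw [List.map_map]
    conv_rhs => rw [← List.map_id l]
    refine List.map_congr_left fun z _ => ?_
    exact (eBquiv ℓ j.k j.Ms j.o).apply_symm_apply z
  have hx : eB ℓ j.k j.Ms j.o ((eBquiv ℓ j.k j.Ms j.o).symm x) = x := (eBquiv ℓ j.k j.Ms j.o).apply_symm_apply x
  conv_lhs => rw [← hx, ← hmap]
  rw [transport_map]
  congr 1
  funext a b
  show F.U (κ * acBond (boxLabels j.Ms j.o) j.Ac (eB ℓ j.k j.Ms j.o a) (eB ℓ j.k j.Ms j.o b)) = F.U (κ * _)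
  rw [B2Lemma24KerOmega.acBond_eB]

/-- **THE HÖLDER TERM OF AN ADMISSIBLE REGION CONTOUR IS DOMINATED BY THE BOX FAMILY's `holderQ`** (same weight, same
transporter, same end values; the contour read on the box is admissible). [cite: Balaban1983RegularityDecay, (1.9) p.573 «U(A(Γ_{x,x′}))»] -/
theorem term_le_holderQ_box {α : ℝ} {μ : Fin (d + 1)} {x x' : ↥(fineDom ((ℓ + 1) ^ j.k) (boxLabels j.Ms j.o))}
    {l : List ↥(fineDom ((ℓ + 1) ^ j.k) (boxLabels j.Ms j.o))} (hl : j.toRegion.Adm μ x x' l)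
    (v : ↥(fineDom ((ℓ + 1) ^ j.k) (boxLabels j.Ms j.o)) × ι → ℝ) :
    j.toRegion.wt α x x' * siteNorm (transport (fieldLink F j.toRegion.κ (acBond (boxLabels j.Ms j.o) j.Ac)) x l
        *ᵥ fld v x' - fld v x)
      ≤ j.boxI.holderQ F α μ (v ∘ ⇑(eBι (ι := ι) ℓ j.k j.Ms j.o)) ((eBquiv ℓ j.k j.Ms j.o).symm x)
          ((eBquiv ℓ j.k j.Ms j.o).symm x') := by
  have hadm := j.adm_symm_of_adm hl
  have key := le_holderQ_box j.boxI F (α := α) (v ∘ ⇑(eBι (ι := ι) ℓ j.k j.Ms j.o)) hadm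
  have htr := j.transport_eq_transport_symm F j.toRegion.κ x l
  have hA : fieldLink F j.boxI.κ j.boxI.AΩ = fieldLink F j.toRegion.κ (fun a b : ↥(Box d ℓ j.k j.Ms) =>
      compField (shiftF ℓ j.k j.o j.Ac) a.1 b.1) := by
    rw [AΩ_boxI]
  have hfld : ∀ y : ↥(fineDom ((ℓ + 1) ^ j.k) (boxLabels j.Ms j.o)),
      fld (v ∘ ⇑(eBι (ι := ι) ℓ j.k j.Ms j.o)) ((eBquiv ℓ j.k j.Ms j.o).symm y) = fld v y := fun y => by
    rw [fld_comp_eBι, ← eBquiv_apply, Equiv.apply_symm_apply]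
  rw [hA, hfld, hfld, ← htr, j.wt_symm_eq] at key
  exact key

end Chart

/-! ## §3. The members: the box Theorem's conclusions, read on the region instance at every point -/

section Members

variable (F : OrthFlow ι) {creg β : ℝ} {K K' : ℕ} {α δB cB RB : ℝ}

variable (hcB : 0 < cB)

/-- **(1.10), VALUE, AT EVERY SITE OF THE LATTICE PARALLELEPIPED, REGION CURRENCY**:
`|(G_k(Ω,A)f)(x)| ≤ c_B e^{−δ_B dist(x, supp f)}‖f‖_∞`. [cite: Balaban1983RegularityDecay, (1.10) p.573 «for rectangular parallelepipeds … without any restrictions»] -/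
theorem valG_region (HB : Ineq19_110 (boxPairFamNC F d ℓ amin aplus m2plus creg β K' j.boxI) α δB cB RB)
    (f : ↥(fineDom ((ℓ + 1) ^ j.k) (boxLabels j.Ms j.o)) × ι → ℝ) (x : ↥(fineDom ((ℓ + 1) ^ j.k) (boxLabels j.Ms j.o))) :
    (regionPairFam F d ℓ amin aplus m2plus creg β K j.toRegion).valG f x
      ≤ cB * Real.exp (-(δB * (regionPairFam F d ℓ amin aplus m2plus creg β K j.toRegion).sdist1 x f))
        * (regionPairFam F d ℓ amin aplus m2plus creg β K j.toRegion).supNorm f := by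
  show siteNorm (fld (j.toRegion.GΩ F *ᵥ f) x) ≤ cB * Real.exp (-(δB * j.toRegion.sdist1 x f)) * supN f
  obtain ⟨a, rfl⟩ := eB_surjective ℓ j.k j.Ms j.o x
  rw [j.fld_GΩ_eB F f a, j.sdist1_eB f a]
  have hB : siteNorm (fld (j.boxI.GΩ F *ᵥ (f ∘ ⇑(eBι (ι := ι) ℓ j.k j.Ms j.o))) a)
      ≤ cB * Real.exp (-(δB * j.boxI.sdist1 a (f ∘ ⇑(eBι (ι := ι) ℓ j.k j.Ms j.o))))
        * supN (f ∘ ⇑(eBι (ι := ι) ℓ j.k j.Ms j.o)) :=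
    (HB.2 (0 : Fin (d + 1)) _ a (Or.inl trivial)).2
  refine hB.trans (le_of_eq ?_)
  rw [supN_comp_eBι]

/-- **(1.10), DERIVATIVE, AT EVERY SITE, REGION CURRENCY.** [cite: Balaban1983RegularityDecay, (1.10) p.573 «for rectangular parallelepipeds … without any restrictions»] -/
theorem valDG_region (HB : Ineq19_110 (boxPairFamNC F d ℓ amin aplus m2plus creg β K' j.boxI) α δB cB RB)
    (μ : Fin (d + 1)) (f : ↥(fineDom ((ℓ + 1) ^ j.k) (boxLabels j.Ms j.o)) × ι → ℝ)
    (x : ↥(fineDom ((ℓ + 1) ^ j.k) (boxLabels j.Ms j.o))) :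
    (regionPairFam F d ℓ amin aplus m2plus creg β K j.toRegion).valDG μ f x
      ≤ cB * Real.exp (-(δB * (regionPairFam F d ℓ amin aplus m2plus creg β K j.toRegion).sdist1 x f))
        * (regionPairFam F d ℓ amin aplus m2plus creg β K j.toRegion).supNorm f := by
  show siteNorm (fld (j.toRegion.DΩ F μ *ᵥ (j.toRegion.GΩ F *ᵥ f)) x)
    ≤ cB * Real.exp (-(δB * j.toRegion.sdist1 x f)) * supN f
  obtain ⟨a, rfl⟩ := eB_surjective ℓ j.k j.Ms j.o x
  rw [j.fld_DΩGΩ_eB F μ f a, j.sdist1_eB f a]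
  have hB : siteNorm (fld (j.boxI.DΩ F μ *ᵥ (j.boxI.GΩ F *ᵥ (f ∘ ⇑(eBι (ι := ι) ℓ j.k j.Ms j.o)))) a)
      ≤ cB * Real.exp (-(δB * j.boxI.sdist1 a (f ∘ ⇑(eBι (ι := ι) ℓ j.k j.Ms j.o))))
        * supN (f ∘ ⇑(eBι (ι := ι) ℓ j.k j.Ms j.o)) :=
    (HB.2 μ _ a (Or.inl trivial)).1
  refine hB.trans (le_of_eq ?_)
  rw [supN_comp_eBι]

include hcB in
/-- **(1.9) AT EVERY PAIR OF THE LATTICE PARALLELEPIPED, REGION CURRENCY** (every admissible region contour is an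
admissible box contour with the same weight, transporter and end values — same constant `c_B`).
[cite: Balaban1983RegularityDecay, (1.9) p.573 «for rectangular parallelepipeds … without any restrictions»] -/
theorem lhs19_region (HB : Ineq19_110 (boxPairFamNC F d ℓ amin aplus m2plus creg β K' j.boxI) α δB cB RB)
    (μ : Fin (d + 1)) (f : ↥(fineDom ((ℓ + 1) ^ j.k) (boxLabels j.Ms j.o)) × ι → ℝ)
    (x x' : ↥(fineDom ((ℓ + 1) ^ j.k) (boxLabels j.Ms j.o))) :
    (regionPairFam F d ℓ amin aplus m2plus creg β K j.toRegion).lhs19 α μ f x x'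
      ≤ cB * Real.exp (-(δB * (regionPairFam F d ℓ amin aplus m2plus creg β K j.toRegion).sdist2 x x' f))
        * (regionPairFam F d ℓ amin aplus m2plus creg β K j.toRegion).supNorm f := by
  show j.toRegion.holderQ F α μ (j.toRegion.DΩ F μ *ᵥ (j.toRegion.GΩ F *ᵥ f)) x x'
    ≤ cB * Real.exp (-(δB * min (j.toRegion.sdist1 x f) (j.toRegion.sdist1 x' f))) * supN f
  have hb0 : 0 ≤ cB * Real.exp (-(δB * min (j.toRegion.sdist1 x f) (j.toRegion.sdist1 x' f))) * supN f := by
    have := supN_nonneg f; positivity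
  refine j.toRegion.holderQ_le F hb0 fun l hl => ?_
  have h1 := j.term_le_holderQ_box F (α := α) hl (j.toRegion.DΩ F μ *ᵥ (j.toRegion.GΩ F *ᵥ f))
  rw [j.DΩGΩ_comp_eBι F μ f] at h1
  have h2 : j.boxI.holderQ F α μ (j.boxI.DΩ F μ *ᵥ (j.boxI.GΩ F *ᵥ (f ∘ ⇑(eBι (ι := ι) ℓ j.k j.Ms j.o))))
        ((eBquiv ℓ j.k j.Ms j.o).symm x) ((eBquiv ℓ j.k j.Ms j.o).symm x')
      ≤ cB * Real.exp (-(δB * min (j.boxI.sdist1 ((eBquiv ℓ j.k j.Ms j.o).symm x) (f ∘ ⇑(eBι (ι := ι) ℓ j.k j.Ms j.o)))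
          (j.boxI.sdist1 ((eBquiv ℓ j.k j.Ms j.o).symm x') (f ∘ ⇑(eBι (ι := ι) ℓ j.k j.Ms j.o)))))
        * supN (f ∘ ⇑(eBι (ι := ι) ℓ j.k j.Ms j.o)) :=
    HB.1 μ (f ∘ ⇑(eBι (ι := ι) ℓ j.k j.Ms j.o)) ((eBquiv ℓ j.k j.Ms j.o).symm x)
      ((eBquiv ℓ j.k j.Ms j.o).symm x') (Or.inl trivial)
  rw [j.sdist1_symm_eq, j.sdist1_symm_eq, supN_comp_eBι] at h2
  exact h1.trans h2

include hcB in
/-- **THEOREM (1.9)–(1.10) ON A LATTICE PARALLELEPIPED WITHOUT RESTRICTION, IN r01's REGION CURRENCY**: from the box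
family's `Ineq19_110` at `boxI` (r04∕p17's Theorem, `rect := True`), `Ineq19_110` for r01's general-region family at
`toRegion` with the same `(α, δ_B, c_B)` and EVERY `R₀` — no point of the parallelepiped is excluded.
[cite: Balaban1983RegularityDecay, Theorem (1.9)–(1.10) p.573 «for rectangular parallelepipeds, the inequalities hold without any restrictions on the points x, x′»] -/
theorem ineq19_110_toRegion (HB : Ineq19_110 (boxPairFamNC F d ℓ amin aplus m2plus creg β K' j.boxI) α δB cB RB)
    (R₀ : ℝ) : Ineq19_110 (regionPairFam F d ℓ amin aplus m2plus creg β K j.toRegion) α δB cB R₀ :=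
  ⟨fun μ f x x' _ => j.lhs19_region F hcB HB μ f x x',
    fun μ f x _ => ⟨j.valDG_region F HB μ f x, j.valG_region F HB f x⟩⟩

end Members

end LatBoxInst

end

end Literature.MathematicalPhysics.QuantumFieldTheory.Balaban1983to89.B4LatticeBoxChart
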